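import Summits.Ventures.QEC.Census.CertBZList
import Summits.Ventures.QEC.Census.BB.A1s_n168_k6_d4a093b6.L1Iface
import HarnessLib

set_option Elab.async false
set_option maxRecDepth 200000

/-!
# `[[168,6,16]]` one-level cover certificate of `A1s_n168_k6_d4a093b6` — LEVEL-1 objects: decided structure facts (`L1Rows`; qec-search-1 g5)

On the objects of `L1Iface`: the rows of both systematic matrices are words below `2^84` and there are 42 of them (hypotheses of the
`CertBZPlaneTree` leaves), the structural verdict `blockStructOK 84 15 eGb eBlock` (both matrices systematic on their information sets,
`|Aᵢ| = |eGb| = 42`, recounted Brouwer–Zimmermann bound `(7+1)+(6+1) = 15`), and every word of the orbit list `eOrb` is below `2^84`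
(hypothesis `hallow` of `CertBZList.mem_allow_of_struct_reaches`). Theorems only; `decide +kernel`; KERNEL. (Pattern of search-9 g5 `L1Rows` p535898.)
-/

namespace Summit.Ventures.QEC.Census.A1s_n168_k6_d4a093b6

open Summit.Ventures.QEC.Census

/-- Rows of level-1 matrix 0 are words below `2^84`. -/
theorem eG0_lt : ∀ g ∈ giRows A1s_n168_k6_d4a093b6.eGb eM0, g < 2 ^ 84 := by
  have h : ((giRows eGb eM0).all fun g => decide (g < 2 ^ 84)) = true := by decide +kernel
  simpa [List.all_eq_true] using h

/-- Rows of level-1 matrix 1 are words below `2^84`. -/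
theorem eG1_lt : ∀ g ∈ giRows A1s_n168_k6_d4a093b6.eGb eM1, g < 2 ^ 84 := by
  have h : ((giRows eGb eM1).all fun g => decide (g < 2 ^ 84)) = true := by decide +kernel
  simpa [List.all_eq_true] using h

/-- Matrix 0 has 42 rows. -/
theorem eG0_len : (giRows A1s_n168_k6_d4a093b6.eGb eM0).length = 42 := by decide +kernel

/-- Matrix 1 has 42 rows. -/
theorem eG1_len : (giRows A1s_n168_k6_d4a093b6.eGb eM1).length = 42 := by decide +kernel

/-- STRUCTURE of the level-1 block (type-10 `blockStructOK`): both matrices systematic on `T₀` / `T₁` with rows below `2^84`,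
`|Aᵢ| = 42`, and the recounted bound reaches `15`. -/
theorem eBlock_struct : blockStructOK 84 15 A1s_n168_k6_d4a093b6.eGb eBlock = true := by decide +kernel

set_option maxHeartbeats 400000000 in
/-- Every word of the orbit list is below `2^84` (one kernel pass over `eOrb`). -/
theorem eOrb_lt : ∀ w ∈ A1s_n168_k6_d4a093b6.eOrb, w < 2 ^ 84 := by
  have h : (eOrb.all fun w => decide (w < 2 ^ 84)) = true := by decide +kernel
  simpa [List.all_eq_true] using h

end Summit.Ventures.QEC.Census.A1s_n168_k6_d4a093b6
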